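import Literature.Computability.MetaComplexity.FunctionalPigeonholeStructure
import HarnessLib

/-!
# Mikša–Nordström's degree lower bound for the graph functional pigeonhole principle, proved

Continuation of `FunctionalPigeonholeStructure.lean`: systems of distinct representatives for small
pigeon sets from boundary expansion (`FPHP.exists_sdr`), hence satisfiability of
`⋀_{u ∈ S} P^u ∧ E` for `|S| ≤ s` (`FPHP.locSol_nonempty`, MN15's arXiv Lemma 32 / Cor. 33
specialised to `FPHP_G`), and the DISCHARGE of the named fact `MiksaNordstrom2015_PC_FPHP_degree`
(Mikša–Nordström CCC 2015 Thm 4.9: over a bipartite `(s, δ)`-boundary expander with left degrees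
`≤ d`, `s ≥ 1`, `δ > 0`, `d ≥ 1`, `FPHP_G` has no PC refutation of degree `≤ k ≤ δs/(2d)` over any
field) through the generalised method `MiksaNordstrom.not_refutableInDegree` (Thm 3.6) for `s ≥ 2`;
for `1 ≤ s < 2` the admissible degree is `0` and no axiom is usable; `m = 0` is Boolean soundness.

Source: M. Mikša, J. Nordström, CCC 2015 (LIPIcs 33) Thm 4.9 and its proof = arXiv:1505.01358
Thm 42 [MiksaNordstrom2015] (held copy `paper:arxiv-1505.01358` p0023).
-/

noncomputable section

namespace Literature.Computability.MetaComplexity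

open Finset MvPolynomial Literature.Computability.Complexity PCResidue MiksaNordstrom

namespace FPHP

variable {m n : ℕ} {N : Fin m → Finset (Fin n)}

/-- **Systems of distinct representatives from boundary expansion**: every set of at most `s`
pigeons can be matched injectively into its holes (peel off a pigeon with a unique-neighbour hole).
[Mikša–Nordström 2015, arXiv:1505.01358 Lemma 32 (p. 17) specialised to `FPHP_G`] [cite: MiksaNordstrom2015, Theorem 4.9] -/
theorem exists_sdr {s δ : ℝ} (hG : IsBoundaryExpander (holeScope N) s δ) (hδ : 0 < δ)
    (S : Finset (Fin m)) (hS : (S.card : ℝ) ≤ s) :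
    ∃ M : Fin m → ℕ, (∀ u ∈ S, ∃ v ∈ N u, M u = v.val) ∧ Set.InjOn M S := by
  classical
  induction hc : S.card using Nat.strong_induction_on generalizing S with
  | _ c ih =>
    by_cases hempty : S = ∅
    · exact ⟨fun _ => 0, by simp [hempty], by simp [hempty]⟩
    -- a boundary hole of `S`
    have hpos : (0 : ℝ) < (boundary (holeScope N) S).card := by
      have h1 := hG S hS
      have h2 : (0 : ℝ) < S.card := by
        exact_mod_cast Finset.card_pos.2 (Finset.nonempty_iff_ne_empty.2 hempty)
      nlinarith
    obtain ⟨x, hx⟩ := Finset.card_pos.1 (by exact_mod_cast hpos)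
    obtain ⟨hcov, hdeg⟩ := mem_boundary.1 hx
    obtain ⟨u, hu, hxu⟩ := mem_cover.1 hcov
    obtain ⟨k, hk, rfl⟩ := mem_holeScope.1 hxu
    rw [coverDegree, Finset.card_eq_one] at hdeg
    obtain ⟨u₀, hu₀⟩ := hdeg
    have huniq : ∀ u' ∈ S, k.val ∈ holeScope N u' → u' = u := fun u' hu' hk' => by
      have h1 : u' ∈ ({u₀} : Finset (Fin m)) := by rw [← hu₀]; exact Finset.mem_filter.2 ⟨hu', hk'⟩
      have h2 : u ∈ ({u₀} : Finset (Fin m)) := by rw [← hu₀]; exact Finset.mem_filter.2 ⟨hu, hxu⟩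
      rw [Finset.mem_singleton.1 h1, Finset.mem_singleton.1 h2]
    -- match the rest by induction
    have hlt : (S.erase u).card < c := by rw [← hc]; exact Finset.card_erase_lt_of_mem hu
    obtain ⟨M', hM', hinj'⟩ := ih _ hlt (S.erase u)
      (le_trans (by exact_mod_cast Finset.card_erase_le) hS) rfl
    refine ⟨Function.update M' u k.val, fun w hw => ?_, fun w₁ hw₁ w₂ hw₂ heq => ?_⟩
    · by_cases hwu : w = u
      · subst hwu; exact ⟨k, hk, Function.update_self _ _ _⟩
      · obtain ⟨v, hv, hMv⟩ := hM' w (Finset.mem_erase.2 ⟨hwu, hw⟩)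
        exact ⟨v, hv, by rw [Function.update_of_ne hwu, hMv]⟩
    · by_cases h₁ : w₁ = u <;> by_cases h₂ : w₂ = u
      · rw [h₁, h₂]
      · rw [h₁, Function.update_self, Function.update_of_ne h₂] at heq
        obtain ⟨v, hv, hMv⟩ := hM' w₂ (Finset.mem_erase.2 ⟨h₂, hw₂⟩)
        exact absurd (huniq w₂ hw₂ (mem_holeScope.2 ⟨v, hv, by rw [← hMv, heq]⟩)) h₂
      · rw [h₂, Function.update_self, Function.update_of_ne h₁] at heq
        obtain ⟨v, hv, hMv⟩ := hM' w₁ (Finset.mem_erase.2 ⟨h₁, hw₁⟩)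
        exact absurd (huniq w₁ hw₁ (mem_holeScope.2 ⟨v, hv, by rw [← hMv, ← heq]⟩)) h₁
      · rw [Function.update_of_ne h₁, Function.update_of_ne h₂] at heq
        exact hinj' (Finset.mem_erase.2 ⟨h₁, hw₁⟩) (Finset.mem_erase.2 ⟨h₂, hw₂⟩) heq

/-- **Small subfamilies are satisfiable**: for `|S| ≤ s` the pigeon axioms of `S` together with all
hole and functionality axioms have a common Boolean root (place the pigeons of `S` along a system
of distinct representatives, everything else false). [Mikša–Nordström 2015, arXiv:1505.01358
Cor. 33 with Lemma 32, for `FPHP_G`] [cite: MiksaNordstrom2015, Theorem 4.9] -/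
theorem locSol_nonempty {s δ : ℝ} (hG : IsBoundaryExpander (holeScope N) s δ) (hδ : 0 < δ)
    (S : Finset (Fin m)) (hS : (S.card : ℝ) ≤ s) : (locSol (fam N) (fixedE N) S).Nonempty := by
  classical
  obtain ⟨M, hM, hinj⟩ := exists_sdr hG hδ S hS
  -- `x_{u,v} := (u ∈ S ∧ M u = v)`
  let x : ℕ → Bool := fun j => decide (∃ u ∈ S, ∃ v ∈ N u, M u = v.val ∧ var n u v = j)
  have hx : ∀ (u : Fin m) (v : Fin n), v ∈ N u → (x (var n u v) = true ↔ u ∈ S ∧ M u = v.val) := by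
    intro u v hv
    simp only [x, decide_eq_true_eq]
    constructor
    · rintro ⟨u', hu', v', -, hM', heq⟩
      obtain ⟨rfl, rfl⟩ := var_inj heq
      exact ⟨hu', hM'⟩
    · rintro ⟨hu, hMu⟩
      exact ⟨u, hu, v, hv, hMu, rfl⟩
  refine ⟨x, fun C hC => ?_, fun u hu C hC => ?_⟩
  · -- hole and functionality axioms: two true variables would break injectivity / functionality
    obtain ⟨u₁, v₁, u₂, v₂, h₁, h₂, hshare, hne, rfl⟩ := exists_of_mem_fixedE hC
    simp only [Clause.eval, List.any_cons, List.any_nil, Bool.or_false, Literal.eval,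
      Bool.or_eq_true, beq_iff_eq]
    by_contra hcon
    rw [not_or] at hcon
    have t₁ : x (var n u₁ v₁) = true := by
      cases hb : x (var n u₁ v₁) with
      | false => exact absurd hb hcon.1
      | true => rfl
    have t₂ : x (var n u₂ v₂) = true := by
      cases hb : x (var n u₂ v₂) with
      | false => exact absurd hb hcon.2
      | true => rfl
    obtain ⟨hS₁, hM₁⟩ := (hx u₁ v₁ h₁).1 t₁
    obtain ⟨hS₂, hM₂⟩ := (hx u₂ v₂ h₂).1 t₂
    apply hne
    rcases hshare with rfl | rfl
    · have : v₁ = v₂ := Fin.ext (hM₁.symm.trans hM₂)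
      rw [this]
    · have : u₁ = u₂ := hinj hS₁ hS₂ (hM₁.trans hM₂.symm)
      rw [this]
  · rw [fam, List.mem_singleton] at hC
    subst hC
    obtain ⟨v, hv, hMv⟩ := hM u hu
    simp only [Clause.eval, List.any_eq_true]
    exact ⟨(var n u v, true), mem_pigeonClause.2 ⟨v, hv, rfl⟩, by
      rw [Literal.eval, (hx u v hv).2 ⟨hu, hMv⟩]; rfl⟩

/-- Every clause of `FPHP_G` is a clause of `E` or of some `𝓕 u`. [Mikša–Nordström 2015, §4.2]
[cite: MiksaNordstrom2015, §4.2] -/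
theorem mem_fphpCNF_cases {C : Clause ℕ} (hC : C ∈ fphpCNF N) :
    C ∈ fixedE N ∨ ∃ u, C ∈ fam N u := by
  rcases List.mem_append.1 hC with hC | hC
  · rcases List.mem_append.1 hC with hC | hC
    · obtain ⟨u, -, rfl⟩ := List.mem_map.1 hC
      exact Or.inr ⟨u, by simp [fam]⟩
    · exact Or.inl (List.mem_append.2 (Or.inl hC))
  · exact Or.inl (List.mem_append.2 (Or.inr hC))

end FPHP

/-! ### Theorem 4.9 -/

/-- **Mikša–Nordström's theorem (CCC 2015, Thm 4.9) holds**: the named fact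
`MiksaNordstrom2015_PC_FPHP_degree` — over a bipartite `(s, δ)`-boundary expander with left
degrees `≤ d` (`s ≥ 1`, `δ > 0`, `d ≥ 1`), `FPHP_G` has no PC refutation of degree `≤ k` for any
`k ≤ δs/(2d)`, over any field — is DISCHARGED by the generalised method
(`MiksaNordstrom.not_refutableInDegree`) applied to the structure of MN15's proof of Thm 4.9.
[Mikša–Nordström 2015, Thm 4.9] [cite: MiksaNordstrom2015, Theorem 4.9] -/
theorem MiksaNordstrom2015_PC_FPHP_degree_holds : MiksaNordstrom2015_PC_FPHP_degree := by
  intro F _ m n N s δ d hs hδ hd hdeg hG k hk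
  classical
  by_cases hs2 : 2 ≤ s
  · refine MiksaNordstrom.not_refutableInDegree (𝓕 := FPHP.fam N) (𝒱 := FPHP.vset N)
      (E := FPHP.fixedE N) (FPHP.isRespExpander hG) hδ hs2 FPHP.vset_respects hd
      (FPHP.overlap_le hdeg) (FPHP.locSol_nonempty hG hδ) (fun C hC => FPHP.mem_fphpCNF_cases hC) ?_
    rwa [mul_zero, sub_zero]
  · -- `1 ≤ s < 2`: the admissible degree is `0`
    by_cases hm : m = 0
    · subst hm
      refine PC.not_refutableInDegree_of_model (x := fun _ => false) (fun f hf => ?_) k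
      obtain ⟨C, hC, rfl⟩ := PC.mem_ofCNF.1 hf
      rcases FPHP.mem_fphpCNF_cases hC with hC | ⟨u, -⟩
      · obtain ⟨u, -⟩ := FPHP.exists_of_mem_fixedE hC
        exact u.elim0
      · exact u.elim0
    · obtain ⟨u₀⟩ : Nonempty (Fin m) := Fin.pos_iff_nonempty.1 (Nat.pos_of_ne_zero hm)
      -- `δ ≤ |∂{u₀}| ≤ |N u₀| ≤ d`, so `k ≤ δ s/(2d) < 1`
      have hδd : δ ≤ d := by
        have h1 := hG {u₀} (by simpa using hs)
        rw [Finset.card_singleton, Nat.cast_one, mul_one] at h1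
        have h2 : (boundary (FPHP.holeScope N) {u₀}).card ≤ (N u₀).card :=
          (Finset.card_le_card (boundary_subset_cover _)).trans
            (by rw [cover, Finset.singleton_biUnion, FPHP.card_holeScope])
        have h3 : ((boundary (FPHP.holeScope N) {u₀}).card : ℝ) ≤ d := by
          exact_mod_cast h2.trans (hdeg u₀)
        linarith
      have hk0 : k = 0 := by
        have hdpos : (0 : ℝ) < d := by exact_mod_cast hd
        have h1 : (k : ℝ) < 1 := by
          refine hk.trans_lt ?_
          rw [div_lt_one (by linarith)]
          nlinarith
        have : k < 1 := by exact_mod_cast h1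
        omega
      subst hk0
      refine PC.not_refutableInDegree_of_lt_totalDegree (fun f hf => ?_) (by norm_num)
      obtain ⟨C, hC, rfl⟩ := PC.mem_ofCNF.1 hf
      rw [PC.totalDegree_ofClause]
      rcases FPHP.mem_fphpCNF_cases hC with hC | ⟨u, hC⟩
      · obtain ⟨u₁, v₁, u₂, v₂, -, -, -, -, rfl⟩ := FPHP.exists_of_mem_fixedE hC
        norm_num
      · rw [FPHP.fam, List.mem_singleton] at hC
        subst hC
        rw [FPHP.length_pigeonClause]
        exact Finset.card_pos.2 (FPHP.exists_mem_of_isBoundaryExpander N hG hs hδ u)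

end Literature.Computability.MetaComplexity
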